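import Summits.BirchSwinnertonDyer.BirchSwinnertonDyer.Theorems.ByReductionTypeAtTwoFineSelmerConjAAtTwoAdditivePotGoodEisensteinDoor
import Literature.NumberTheory.EllipticCurves.Rank1Residual.MuLambdaCarriers
import HarnessLib

/-!
# Route `ByReductionTypeAtTwo` (rung K4), crux `SupersingularRankZeroAtTwo` (item stmt-BirchSwinnertonDyer-19097), registry v2.11 stub 3
# `stub_allMuFlatOfNonSurj` → v2.12 (α) `FineMuZeroOnHabitatAtTwo`: THE CLASS-WIDE GOOD-SUPERSINGULAR EISENSTEIN DOOR —
# Coates–Sujatha (A)₂ / `Rank1Residual.FineMuZeroAt W 2` for a curve with good SUPERSINGULAR reduction at `2`, ON ITS MINIMAL MODEL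
# `[0, a₂, 1, a₄, a₆]`, from ONE parity bit «`2 ∤ h(L_W)`» of its `2`-division cubic field `L_W = ℚ(x(P))`, modulo print `hLim2`
# (a `--supports 19097` file; seat `bsd-2adic-t42` GEN 43, hand h12 «D84 ROW-CERTIFICATE TYPING», director (810)(B) HAND 1; pen certificate
# `plan/gen39/ACCEPTANCE-SHAPES-h12-ROWS.lean` @4d34e939283ad14e supplies §3 verbatim)

HONEST LABEL (cell `bsd-2adic`, D-0036/D-0054): «row certificates mod print (Lim 2017 Thm 3.5); (α) is class-wide and NOT discharged;
CDC_H closed MOD PRINT hPT; BSD proved for no curve». This file types-the-object-of; it closes nothing at the `∀`-level; nothing is booked.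
§1 is UNCONDITIONAL kernel plumbing; §2–§4 are conditional on `hLim2` (Lim 2017 Thm. 3.5 + Lemma 3.2 at `2`) BY NAME and on ONE
displayed parity bit `2 ∤ #Cl(𝓞 ℚ(β))` — which §4 turns into a KERNEL bit whenever a small generator of `ℚ(β)` is supplied.

THE MECHANISM (Tate at `2` + Eisenstein; elementary). On the habitat of crux 19097 (non-CM, `r_an = 0`, GOOD SUPERSINGULAR at `2`) the
reduced minimal model `[a₁, a₂, a₃, a₄, a₆]` has `a₁ = 0` (good reduction at `2` is supersingular iff the Hasse invariant `ã₁` vanishes)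
and then `a₃` odd, i.e. `a₃ = 1` after reduction (with `a₁ = 0` and `a₃` even, `Δ = 16·disc − …` is even: bad at `2`); Cremona's `allcurves`
confirms `a₁ = 0, a₃ = 1` on all 104 habitat classes `N ≤ 600` (cell memo `t42/D84-ROWS-GEN43.md`). For `W = [0, a₂, 1, a₄, a₆]` the
`2`-division polynomial is `4x³ + 4a₂x² + 4a₄x + (4a₆ + 1)`, so a non-zero `P ∈ W[2]` is `(β/4, −1/2)` with `β = 4x(P)` a root of
`X³ + 4a₂X² + 16a₄X + (64a₆ + 16)` (§1: `disc = 256·Δ(W)`; `P ≠ 0`; `Stab_{Γ_ℚ}(P) = Stab(β)`; **point field `ℚ(P) = ℚ(β)`**), and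
`π = β/2 = 2x(P)` is a root of the EISENSTEIN cubic `Y³ + 2a₂Y² + 4a₄Y + (8a₆ + 2)` — all coefficients even, `4 ∤ 8a₆ + 2` WITH NO
HYPOTHESIS — so `2 = 𝔮³` is totally ramified in `L_W = ℚ(β) = ℚ(π)` and the tree's Eisenstein door
`AddKatoTwo.fineSelmerDual_moduleFinite_two_of_eisenstein_pointField` (Iwasawa 1956: one totally ramified prime + `2 ∤ h` ⟹ `μ₂ = 0` along
EVERY `ℤ₂`-extension of `L_W`, kernel; then Lim 2017 Thm. 3.5 BY NAME) yields (A)₂(W).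

* §1 `goodSSModel_Δ` (`256·Δ = disc`), `isElliptic_goodSSModel`, `nonsingular_goodSSModel_root`, `exists_geomTorsion_two_goodSSModel_eq_some`,
  `smul_goodSSModel_eq_iff_smul_root_eq`, **`fixedField_stabilizer_goodSSModel_eq_adjoin_root`** (`Stab(P) = Stab(β)`, Krull).
* §2 **`conjA_two_goodSSModel_of_oddClassNumber`** `(hLim2) (a₂ a₄ a₆ : ℤ) (hp : p = 4a₂) (hq : q = 16a₄) (hr : r = 64a₆ + 16) [IsElliptic]
  (hβ : β root of X³ + pX² + qX + r) (hh : 2 ∤ #Cl(𝓞 ℚ(β))) (κ) (hκ)` ⟹ (A)₂ ON THE MINIMAL MODEL (`∃ γ D` = `Rank1Residual.ConjAAt · 2`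
  unfolded) and **`fineMuZeroAt_two_goodSSModel_of_oddClassNumber`** (`Rank1Residual.FineMuZeroAt [0,a₂,1,a₄,a₆] 2`, the (α) binder's
  currency); the row stamps `…GoodSSRowStampsA/B` are one-line applications on Cremona's minimal models (no `variableChange` transport).
* §3 the pen's CUBIC-MODEL shape (scratch :33/:83 verbatim): `conjA_two_cubicModel_goodSSShape_of_oddClassNumber (hLim2) (c b₄ b₆ : ℤ)
  (hb₆ : Odd b₆) [IsElliptic [0,4c,0,8b₄,16b₆]] (hβ) (hh) (κ) (hκ)` + `fineMuZeroAt_…` (`(c, b₄, b₆) = (a₂, 2a₄, 4a₆ + 1)` on the habitat).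
* §4 GENERATOR SWAP for KERNEL bits: `conjA_two_goodSSModel_of_generator` / `fineMuZeroAt_two_goodSSModel_of_generator` — a `θ = u₀ + u₁β +
  u₂β²` that is a root of an integer cubic `g` with `β ∈ ℚ + ℚθ + ℚθ²` (two `linear_combination`s per row) and `2 ∤ #Cl(𝓞 ℚ(θ))` for
  every root of `g` (`|disc g| ≤ 45`: `…CubicDiscriminant`; Eisenstein `r = ±2`, `|disc g| ≤ 108`: `…MinkowskiDoor`; or a norm/cube
  certificate) give (A)₂(W) / `FineMuZeroAt W 2` modulo `hLim2` ALONE.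

What this is NOT: no `∀`-level claim; (α) is not discharged (the rows are its BC5-type witnesses / honesty data); no registry write;
`IsGloballyMinimal`, `¬CM`, `r_an = 0`, `GoodSS` of the rows are NOT kernel claims here (prose/census only); BSD is proved for no curve.

References: [Lim2017FineSelmer] Thm. 3.5, Lemma 3.2; [CoatesSujatha2005] (A); [Greenberg2001IwasawaPastPresent] Prop. 2.1 p. 339 (Iwasawa 1956);
[SilvermanAEC2009] III.§1 (b-invariants, `(x,y) ↦ (u²x + r, u³y + su²x + t)`), proof of Prop. III.4.2(a) (`2`-division polynomial), VIII.§1,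
App. A Prop. 1.1 (Tate's values at `2`); [Neukirch1999] II.§6 (Eisenstein polynomials); Cremona `ecdata/allcurves` (minimal models).
-/

set_option autoImplicit false
-- sibling precedent (`…EisensteinDoor.lean`): the directory name repeats the summit name
set_option linter.dupNamespace false

noncomputable section

open scoped Classical IntermediateField NumberField

namespace Summit.BirchSwinnertonDyer.BirchSwinnertonDyer.Theorems.AddKatoTwo

open WeierstrassCurve Field Polynomial IsDedekindDomain Literature.NumberTheory.EllipticCurves
  Literature.NumberTheory.GaloisRepresentations Literature.NumberTheory.IwasawaTheory
  Summit.BirchSwinnertonDyer.BirchSwinnertonDyer.Theorems.AlignedTransportAtTwoTorsionPointField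
  Summit.BirchSwinnertonDyer.BirchSwinnertonDyer.Theses.ByReductionTypeAtTwo

/-! ## §1 The good-supersingular minimal shape `[0, a₂, 1, a₄, a₆]`: its `2`-torsion point `(β/4, −1/2)` and the point field `ℚ(β)` -/

section GoodSSModel

variable (a₂ a₄ a₆ : ℤ)

/-- `256 · Δ([0, a₂, 1, a₄, a₆] ⊗ ℚ) = disc(X³ + 4a₂X² + 16a₄X + (64a₆ + 16))` (the `2`-division cubic of `β = 4x`). [folklore] -/
theorem goodSSModel_Δ :
    256 * ((⟨0, a₂, 1, a₄, a₆⟩ : WeierstrassCurve ℤ).baseChange ℚ).Δ =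
      Cubic.discr ⟨1, ((4 * a₂ : ℤ) : ℚ), ((16 * a₄ : ℤ) : ℚ), ((64 * a₆ + 16 : ℤ) : ℚ)⟩ := by
  simp only [WeierstrassCurve.baseChange, WeierstrassCurve.map_Δ, eq_intCast]
  simp only [WeierstrassCurve.Δ, WeierstrassCurve.b₂, WeierstrassCurve.b₄, WeierstrassCurve.b₆, WeierstrassCurve.b₈, Cubic.discr]
  push_cast
  ring

/-- `[0, a₂, 1, a₄, a₆] ⊗ ℚ` (Cremona model, cell currency `M ⊗ ℚ`) is an elliptic curve as soon as `disc(X³ + 4a₂X² + 16a₄X + (64a₆ + 16)) ≠ 0`.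
[folklore] -/
theorem isElliptic_goodSSModel (h : Cubic.discr ⟨1, ((4 * a₂ : ℤ) : ℚ), ((16 * a₄ : ℤ) : ℚ), ((64 * a₆ + 16 : ℤ) : ℚ)⟩ ≠ 0) :
    ((⟨0, a₂, 1, a₄, a₆⟩ : WeierstrassCurve ℤ).baseChange ℚ).IsElliptic :=
  ⟨by rw [isUnit_iff_ne_zero]; intro h0; apply h; rw [← goodSSModel_Δ, h0, mul_zero]⟩

/-- For a root `β ∈ ℚ̄` of `X³ + 4a₂X² + 16a₄X + (64a₆ + 16)`, the point `(β/4, −1/2)` lies on `[0, a₂, 1, a₄, a₆]` over `ℚ̄` (and is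
non-singular, the curve being elliptic). [cite: SilvermanAEC2009, proof of Prop. III.4.2(a)] -/
theorem nonsingular_goodSSModel_root [((⟨0, a₂, 1, a₄, a₆⟩ : WeierstrassCurve ℤ).baseChange ℚ).IsElliptic] {β : AlgebraicClosure ℚ}
    (hβ : aeval β (Cubic.toPoly ⟨1, ((4 * a₂ : ℤ) : ℚ), ((16 * a₄ : ℤ) : ℚ), ((64 * a₆ + 16 : ℤ) : ℚ)⟩) = 0) :
    (((⟨0, a₂, 1, a₄, a₆⟩ : WeierstrassCurve ℤ).baseChange ℚ).baseChange (AlgebraicClosure ℚ)).toAffine.Nonsingular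
      (algebraMap ℚ (AlgebraicClosure ℚ) (1 / 4) * β) (algebraMap ℚ (AlgebraicClosure ℚ) (-1 / 2)) := by
  rw [← Affine.equation_iff_nonsingular, Affine.equation_iff]
  simp only [Cubic.toPoly, map_one, one_mul, aeval_add, aeval_mul, aeval_C, aeval_X_pow, aeval_X, eq_ratCast] at hβ
  simp only [baseChange, map_a₁, map_a₂, map_a₃, map_a₄, map_a₆, map_zero, map_one, eq_ratCast, eq_intCast]
  push_cast at hβ ⊢
  linear_combination -hβ / 64

/-- The `Γ_ℚ`-action on an affine geometric point is coordinatewise (definitionally). -/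
private theorem smul_some_eq_some (E : WeierstrassCurve ℚ) (g : absoluteGaloisGroup ℚ) {x y : AlgebraicClosure ℚ}
    (h : (E.baseChange (AlgebraicClosure ℚ)).toAffine.Nonsingular x y) :
    ∃ h', @HSMul.hSMul (absoluteGaloisGroup ℚ) (geomPoints E) (geomPoints E) instHSMul g (Affine.Point.some x y h) =
      Affine.Point.some (g • x) (g • y) h' :=
  ⟨_, rfl⟩

/-- Affine points with equal coordinates are equal (proof-irrelevant form). -/
private theorem some_eq_some_of_eq {R : Type} [CommRing R] {V : WeierstrassCurve R} {x y x' y' : R}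
    (hx : x = x') (hy : y = y') (h : V.toAffine.Nonsingular x y) (h' : V.toAffine.Nonsingular x' y') :
    Affine.Point.some x y h = Affine.Point.some x' y' h' := by
  subst hx hy; rfl

/-- `Γ_ℚ` fixes the image of `ℚ` in `ℚ̄`. [folklore] -/
private theorem smul_algebraMap (g : absoluteGaloisGroup ℚ) (c : ℚ) :
    g • algebraMap ℚ (AlgebraicClosure ℚ) c = algebraMap ℚ (AlgebraicClosure ℚ) c := by
  rw [Algebra.algebraMap_eq_smul_one, smul_comm, smul_one]

/-- **The `2`-torsion point `P_β = (β/4, −1/2)` of `[0, a₂, 1, a₄, a₆]`** (`β` a root of `X³ + 4a₂X² + 16a₄X + (64a₆ + 16)` in `ℚ̄`):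
a NON-ZERO element of `W[2]` whose underlying geometric point is `(β/4, −1/2)` (`2P = 0` iff `y = −y − a₁x − a₃ = −y − 1`).
[cite: SilvermanAEC2009, Group Law Algorithm III.2.3 and proof of Prop. III.4.2(a)] -/
theorem exists_geomTorsion_two_goodSSModel_eq_some [((⟨0, a₂, 1, a₄, a₆⟩ : WeierstrassCurve ℤ).baseChange ℚ).IsElliptic]
    {β : AlgebraicClosure ℚ} (hβ : aeval β (Cubic.toPoly ⟨1, ((4 * a₂ : ℤ) : ℚ), ((16 * a₄ : ℤ) : ℚ), ((64 * a₆ + 16 : ℤ) : ℚ)⟩) = 0) :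
    ∃ P : geomTorsion ((⟨0, a₂, 1, a₄, a₆⟩ : WeierstrassCurve ℤ).baseChange ℚ) 2, P ≠ 0 ∧
      @Eq (geomPoints ((⟨0, a₂, 1, a₄, a₆⟩ : WeierstrassCurve ℤ).baseChange ℚ)) P
        (Affine.Point.some _ _ (nonsingular_goodSSModel_root a₂ a₄ a₆ hβ)) := by
  have h2 : (2 : ℕ) • (show geomPoints ((⟨0, a₂, 1, a₄, a₆⟩ : WeierstrassCurve ℤ).baseChange ℚ) from
      Affine.Point.some _ _ (nonsingular_goodSSModel_root a₂ a₄ a₆ hβ)) = 0 := by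
    refine (two_nsmul_some_eq_zero_iff_eq_negY _ (nonsingular_goodSSModel_root a₂ a₄ a₆ hβ)).mpr ?_
    simp only [Affine.negY, baseChange, map_a₁, map_a₃, map_zero, map_one, zero_mul, sub_zero]
    simp only [eq_ratCast]
    push_cast
    ring
  have hmem : (show geomPoints ((⟨0, a₂, 1, a₄, a₆⟩ : WeierstrassCurve ℤ).baseChange ℚ) from
      Affine.Point.some _ _ (nonsingular_goodSSModel_root a₂ a₄ a₆ hβ)) ∈
        geomTorsion ((⟨0, a₂, 1, a₄, a₆⟩ : WeierstrassCurve ℤ).baseChange ℚ) 2 := by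
    change _ ∈ (Submodule.torsionBy ℤ _ (2 : ℤ)).toAddSubgroup
    rw [Submodule.mem_toAddSubgroup, Submodule.mem_torsionBy_iff, ofNat_zsmul]
    exact h2
  refine ⟨⟨_, hmem⟩, fun h0 => ?_, rfl⟩
  exact Affine.Point.some_ne_zero _ (congrArg Subtype.val h0)

/-- **`σ ∈ Γ_ℚ` fixes `P_β = (β/4, −1/2)` iff `σ β = β`.** [folklore] -/
theorem smul_goodSSModel_eq_iff_smul_root_eq [((⟨0, a₂, 1, a₄, a₆⟩ : WeierstrassCurve ℤ).baseChange ℚ).IsElliptic]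
    {β : AlgebraicClosure ℚ} (hβ : aeval β (Cubic.toPoly ⟨1, ((4 * a₂ : ℤ) : ℚ), ((16 * a₄ : ℤ) : ℚ), ((64 * a₆ + 16 : ℤ) : ℚ)⟩) = 0)
    {P : geomTorsion ((⟨0, a₂, 1, a₄, a₆⟩ : WeierstrassCurve ℤ).baseChange ℚ) 2}
    (hP : @Eq (geomPoints ((⟨0, a₂, 1, a₄, a₆⟩ : WeierstrassCurve ℤ).baseChange ℚ)) P
      (Affine.Point.some _ _ (nonsingular_goodSSModel_root a₂ a₄ a₆ hβ)))
    (σ : absoluteGaloisGroup ℚ) : σ • P = P ↔ σ • β = β := by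
  rw [Subtype.ext_iff, AddSubgroup.torsionBy.coe_smul, hP]
  obtain ⟨h', e⟩ := smul_some_eq_some ((⟨0, a₂, 1, a₄, a₆⟩ : WeierstrassCurve ℤ).baseChange ℚ) σ (nonsingular_goodSSModel_root a₂ a₄ a₆ hβ)
  rw [e]
  have h4 : algebraMap ℚ (AlgebraicClosure ℚ) (1 / 4) ≠ 0 := by
    rw [Ne, map_eq_zero_iff _ (algebraMap ℚ (AlgebraicClosure ℚ)).injective]; norm_num
  constructor
  · intro h
    have hx := (Affine.Point.some.inj h).1
    rw [smul_mul', smul_algebraMap] at hx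
    exact mul_left_cancel₀ h4 hx
  · intro h
    exact some_eq_some_of_eq (by rw [smul_mul', smul_algebraMap, h]) (smul_algebraMap σ _) h' _

/-- **The point field of `P_β = (β/4, −1/2)` is `ℚ(β)`**: `ℚ̄^{Stab(P_β)} = ℚ⟮β⟯` — the `2`-torsion point field `L_W = ℚ(x(P))` of the
good-supersingular minimal model, identified with the cubic field of its `2`-division cubic. [cite: SilvermanAEC2009, VIII.§1] -/
theorem fixedField_stabilizer_goodSSModel_eq_adjoin_root [((⟨0, a₂, 1, a₄, a₆⟩ : WeierstrassCurve ℤ).baseChange ℚ).IsElliptic]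
    {β : AlgebraicClosure ℚ} (hβ : aeval β (Cubic.toPoly ⟨1, ((4 * a₂ : ℤ) : ℚ), ((16 * a₄ : ℤ) : ℚ), ((64 * a₆ + 16 : ℤ) : ℚ)⟩) = 0)
    {P : geomTorsion ((⟨0, a₂, 1, a₄, a₆⟩ : WeierstrassCurve ℤ).baseChange ℚ) 2}
    (hP : @Eq (geomPoints ((⟨0, a₂, 1, a₄, a₆⟩ : WeierstrassCurve ℤ).baseChange ℚ)) P
      (Affine.Point.some _ _ (nonsingular_goodSSModel_root a₂ a₄ a₆ hβ))) :
    IntermediateField.fixedField (MulAction.stabilizer (absoluteGaloisGroup ℚ) P) = IntermediateField.adjoin ℚ {β} := by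
  have hst : MulAction.stabilizer (absoluteGaloisGroup ℚ) P = MulAction.stabilizer (absoluteGaloisGroup ℚ) β := by
    ext σ
    rw [MulAction.mem_stabilizer_iff, MulAction.mem_stabilizer_iff, smul_goodSSModel_eq_iff_smul_root_eq a₂ a₄ a₆ hβ hP σ]
  rw [hst, fixedField_stabilizer_eq_adjoin]
  -- the two `Algebra ℚ ℚ̄` instance paths agree
  congr 1

end GoodSSModel

/-! ## §2 THE DOOR ON THE MINIMAL MODEL: (A)₂ and `FineMuZeroAt · 2` for `[0, a₂, 1, a₄, a₆]` from ONE parity bit, modulo `hLim2` -/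

section MinimalModelDoor

/-- **CLASS-WIDE GOOD-SUPERSINGULAR EISENSTEIN DOOR, minimal model.** Granted Lim 2017 Thm. 3.5 at `2` BY NAME (`hLim2`): for integers
`a₂ a₄ a₆` with `W = [0, a₂, 1, a₄, a₆]` elliptic, `(p, q, r) = (4a₂, 16a₄, 64a₆ + 16)`, any root `β ∈ ℚ̄` of `X³ + pX² + qX + r`
(`β = 4x(P)`, `P ∈ W[2] ∖ 0`), and the ONE displayed bit `2 ∤ #Cl(𝓞 ℚ(β))`: statement (A)₂(W) (`∃ γ D`, = `Rank1Residual.ConjAAt W 2`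
unfolded). Inside: `π = β/2` is a root of the Eisenstein cubic `Y³ + 2a₂Y² + 4a₄Y + (8a₆ + 2)` (`4 ∤ 8a₆ + 2` for free), `ℚ(P) = ℚ(β) =
ℚ(π)` (§1), and `…EisensteinDoor.fineSelmerDual_moduleFinite_two_of_eisenstein_pointField`. CONDITIONAL on `hLim2` and the bit; no claim
about `IsGloballyMinimal`/`GoodSS`/`r_an` is made or needed. [cite: Lim2017FineSelmer, §3 Thm. 3.5 and Lemma 3.2]
[cite: Greenberg2001IwasawaPastPresent, Prop. 2.1 p. 339] [cite: CoatesSujatha2005, §3 statement (A)] -/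
theorem conjA_two_goodSSModel_of_oddClassNumber
    (hLim2 : Lim2017.thm35_at_two_fineSelmerDual_moduleFinite_of_classicalMuVanishes_of_le_divisionField_four)
    (a₂ a₄ a₆ : ℤ) {p q r : ℤ} (hp : p = 4 * a₂) (hq : q = 16 * a₄) (hr : r = 64 * a₆ + 16)
    [((⟨0, a₂, 1, a₄, a₆⟩ : WeierstrassCurve ℤ).baseChange ℚ).IsElliptic]
    {β : AlgebraicClosure ℚ} (hβ : aeval β (Cubic.toPoly ⟨1, (p : ℚ), (q : ℚ), (r : ℚ)⟩) = 0)
    (hh : ¬ 2 ∣ Nat.card (ClassGroup (𝓞 (IntermediateField.adjoin ℚ {β}))))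
    (κ : ZpExtension ℚ 2) (hκ : κ.IsCyclotomic) :
    ∃ (γ : absoluteGaloisGroup ℚ)
      (D : ((⟨0, a₂, 1, a₄, a₆⟩ : WeierstrassCurve ℤ).baseChange ℚ).FineSelmerDualData κ γ),
      Module.Finite ℤ_[2] (RestrictScalars ℤ_[2] (IwasawaAlgebra 2) D.X) := by
  subst hp hq hr
  have hβ' : β ^ 3 + (4 * (a₂ : AlgebraicClosure ℚ)) * β ^ 2 + (16 * (a₄ : AlgebraicClosure ℚ)) * β
      + (64 * (a₆ : AlgebraicClosure ℚ) + 16) = 0 := by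
    have := hβ
    simp only [Cubic.toPoly, map_one, one_mul, aeval_add, aeval_mul, aeval_C, aeval_X_pow, aeval_X,
      eq_ratCast, Rat.cast_intCast] at this
    push_cast at this
    linear_combination this
  set π : AlgebraicClosure ℚ := algebraMap ℚ (AlgebraicClosure ℚ) (1 / 2 : ℚ) * β with hπdef
  have hπ : aeval π (Cubic.toPoly ⟨1, ((2 * a₂ : ℤ) : ℚ), ((4 * a₄ : ℤ) : ℚ), ((8 * a₆ + 2 : ℤ) : ℚ)⟩) = 0 := by
    simp only [Cubic.toPoly, map_one, one_mul, aeval_add, aeval_mul, aeval_C, aeval_X_pow, aeval_X, eq_ratCast,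
      Rat.cast_intCast]
    rw [hπdef]
    simp only [eq_ratCast]
    push_cast
    linear_combination ((1 : AlgebraicClosure ℚ) / 8) * hβ'
  have hadj : IntermediateField.adjoin ℚ {π} = IntermediateField.adjoin ℚ {β} := by
    apply le_antisymm
    · rw [IntermediateField.adjoin_simple_le_iff, hπdef]
      exact mul_mem (algebraMap_mem _ _) (IntermediateField.mem_adjoin_simple_self ℚ β)
    · rw [IntermediateField.adjoin_simple_le_iff]
      have hβeq : β = algebraMap ℚ (AlgebraicClosure ℚ) (2 : ℚ) * π := by
        rw [hπdef]; simp only [eq_ratCast]; push_cast; ring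
      rw [hβeq]
      exact mul_mem (algebraMap_mem _ _) (IntermediateField.mem_adjoin_simple_self ℚ π)
  obtain ⟨P₀, hP₀, hP₀eq⟩ := exists_geomTorsion_two_goodSSModel_eq_some a₂ a₄ a₆ hβ
  have hF : IntermediateField.fixedField (MulAction.stabilizer (absoluteGaloisGroup ℚ) P₀) =
      IntermediateField.adjoin ℚ {π} := by
    rw [fixedField_stabilizer_goodSSModel_eq_adjoin_root _ _ _ hβ hP₀eq, hadj]
  have hh' : ¬ 2 ∣ Nat.card (ClassGroup (𝓞 (IntermediateField.adjoin ℚ {π}))) := by rw [hadj]; exact hh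
  have hr4 : ¬ (4 : ℤ) ∣ 8 * a₆ + 2 := by omega
  exact fineSelmerDual_moduleFinite_two_of_eisenstein_pointField hLim2 _ hP₀ (p := 2 * a₂) (q := 4 * a₄) (r := 8 * a₆ + 2)
    (even_two_mul a₂) ⟨2 * a₄, by ring⟩ ⟨4 * a₆ + 1, by ring⟩ hr4 hπ hF hh' κ hκ

/-- **`FineMuZeroAt` on the minimal model** — the currency of the registry's v2.12 (α) binder `Rank1Residual.FineMuZeroAt W 2`: for
`W = [0, a₂, 1, a₄, a₆]` elliptic, `(p, q, r) = (4a₂, 16a₄, 64a₆ + 16)`, a root `β` and the bit `2 ∤ #Cl(𝓞 ℚ(β))`, granted `hLim2`.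
[cite: Lim2017FineSelmer, §3 Thm. 3.5 and Lemma 3.2] [cite: CoatesSujatha2005, §3 statement (A)] -/
theorem fineMuZeroAt_two_goodSSModel_of_oddClassNumber
    (hLim2 : Lim2017.thm35_at_two_fineSelmerDual_moduleFinite_of_classicalMuVanishes_of_le_divisionField_four)
    (a₂ a₄ a₆ : ℤ) {p q r : ℤ} (hp : p = 4 * a₂) (hq : q = 16 * a₄) (hr : r = 64 * a₆ + 16)
    [((⟨0, a₂, 1, a₄, a₆⟩ : WeierstrassCurve ℤ).baseChange ℚ).IsElliptic]
    {β : AlgebraicClosure ℚ} (hβ : aeval β (Cubic.toPoly ⟨1, (p : ℚ), (q : ℚ), (r : ℚ)⟩) = 0)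
    (hh : ¬ 2 ∣ Nat.card (ClassGroup (𝓞 (IntermediateField.adjoin ℚ {β})))) :
    Literature.NumberTheory.EllipticCurves.Rank1Residual.FineMuZeroAt
      ((⟨0, a₂, 1, a₄, a₆⟩ : WeierstrassCurve ℤ).baseChange ℚ) 2 :=
  Literature.NumberTheory.EllipticCurves.Rank1Residual.ConjAAt.fineMuZeroAt
    (fun κ hκ ↦ conjA_two_goodSSModel_of_oddClassNumber hLim2 a₂ a₄ a₆ hp hq hr hβ hh κ hκ)

end MinimalModelDoor

/-! ## §3 The pen's CUBIC-MODEL shape (`b₂ = 4c`, `b₆` odd): `y² = x³ + 4c·x² + 8b₄·x + 16b₆` -/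

section CubicModelDoor

/-- **CLASS-WIDE good-ss Eisenstein door, cubic-model shape (`b₂ = 4c`, `b₆` odd)** (pen certificate `ACCEPTANCE-SHAPES-h12-ROWS.lean`
:33, verbatim). (A)₂ for the cubic model `y² = x³ + 4c·x² + 8b₄·x + 16b₆` — the `ℚ`-isomorphic image `(x, y) ↦ (4x, 8y + 4a₁x + 4a₃)`
of `[a₁, a₂, a₃, a₄, a₆]` with `b₂ = a₁² + 4a₂ = 4c`, `b₄ = 2a₄ + a₁a₃`, `b₆ = a₃² + 4a₆` (odd on the habitat: `a₁ = 0`, `a₃ = 1`) —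
from `hLim2` and the parity bit of `ℚ(β)`, `β` a root of `X³ + 4cX² + 8b₄X + 16b₆`; `π = β/2` is a root of the Eisenstein cubic
`Y³ + 2cY² + 2b₄Y + 2b₆`. [cite: Lim2017FineSelmer, §3 Thm. 3.5 and Lemma 3.2] [cite: Greenberg2001IwasawaPastPresent, Prop. 2.1 p. 339] -/
theorem conjA_two_cubicModel_goodSSShape_of_oddClassNumber
    (hLim2 : Lim2017.thm35_at_two_fineSelmerDual_moduleFinite_of_classicalMuVanishes_of_le_divisionField_four)
    (c b₄ b₆ : ℤ) (hb₆ : Odd b₆)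
    [((⟨0, ((4 * c : ℤ) : ℚ), 0, ((8 * b₄ : ℤ) : ℚ), ((16 * b₆ : ℤ) : ℚ)⟩ : WeierstrassCurve ℚ)).IsElliptic]
    {β : AlgebraicClosure ℚ}
    (hβ : aeval β (Cubic.toPoly ⟨1, ((4 * c : ℤ) : ℚ), ((8 * b₄ : ℤ) : ℚ), ((16 * b₆ : ℤ) : ℚ)⟩) = 0)
    (hh : ¬ 2 ∣ Nat.card (ClassGroup (𝓞 (IntermediateField.adjoin ℚ {β}))))
    (κ : ZpExtension ℚ 2) (hκ : κ.IsCyclotomic) :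
    ∃ (γ : absoluteGaloisGroup ℚ)
      (D : (⟨0, ((4 * c : ℤ) : ℚ), 0, ((8 * b₄ : ℤ) : ℚ), ((16 * b₆ : ℤ) : ℚ)⟩ : WeierstrassCurve ℚ).FineSelmerDualData κ γ),
      Module.Finite ℤ_[2] (RestrictScalars ℤ_[2] (IwasawaAlgebra 2) D.X) := by
  have hβ' : β ^ 3 + (4 * (c : AlgebraicClosure ℚ)) * β ^ 2 + (8 * (b₄ : AlgebraicClosure ℚ)) * β
      + 16 * (b₆ : AlgebraicClosure ℚ) = 0 := by
    have := hβ
    simp only [Cubic.toPoly, map_one, one_mul, aeval_add, aeval_mul, aeval_C, aeval_X_pow, aeval_X,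
      eq_ratCast, Rat.cast_intCast] at this
    push_cast at this
    linear_combination this
  set π : AlgebraicClosure ℚ := algebraMap ℚ (AlgebraicClosure ℚ) (1 / 2 : ℚ) * β with hπdef
  have hπ : aeval π (Cubic.toPoly ⟨1, ((2 * c : ℤ) : ℚ), ((2 * b₄ : ℤ) : ℚ), ((2 * b₆ : ℤ) : ℚ)⟩) = 0 := by
    simp only [Cubic.toPoly, map_one, one_mul, aeval_add, aeval_mul, aeval_C, aeval_X_pow, aeval_X, eq_ratCast,
      Rat.cast_intCast]
    rw [hπdef]
    simp only [eq_ratCast]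
    push_cast
    linear_combination ((1 : AlgebraicClosure ℚ) / 8) * hβ'
  have hadj : IntermediateField.adjoin ℚ {π} = IntermediateField.adjoin ℚ {β} := by
    apply le_antisymm
    · rw [IntermediateField.adjoin_simple_le_iff, hπdef]
      exact mul_mem (algebraMap_mem _ _) (IntermediateField.mem_adjoin_simple_self ℚ β)
    · rw [IntermediateField.adjoin_simple_le_iff]
      have hβeq : β = algebraMap ℚ (AlgebraicClosure ℚ) (2 : ℚ) * π := by
        rw [hπdef]; simp only [eq_ratCast]; push_cast; ring
      rw [hβeq]
      exact mul_mem (algebraMap_mem _ _) (IntermediateField.mem_adjoin_simple_self ℚ π)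
  obtain ⟨P₀, hP₀, hP₀eq⟩ :=
    exists_geomTorsion_two_eq_some_root (((4 * c : ℤ) : ℚ)) (((8 * b₄ : ℤ) : ℚ)) (((16 * b₆ : ℤ) : ℚ)) hβ
  have hF : IntermediateField.fixedField (MulAction.stabilizer (absoluteGaloisGroup ℚ) P₀) =
      IntermediateField.adjoin ℚ {π} := by
    rw [fixedField_stabilizer_eq_adjoin_root _ _ _ hβ hP₀eq, hadj]
    all_goals try congr 1
  have hh' : ¬ 2 ∣ Nat.card (ClassGroup (𝓞 (IntermediateField.adjoin ℚ {π}))) := by rw [hadj]; exact hh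
  have hr4 : ¬ (4 : ℤ) ∣ 2 * b₆ := by
    rintro ⟨k, hk⟩
    obtain ⟨m, hm⟩ := hb₆
    omega
  exact fineSelmerDual_moduleFinite_two_of_eisenstein_pointField hLim2 _ hP₀ (p := 2 * c) (q := 2 * b₄) (r := 2 * b₆)
    (even_two_mul c) (even_two_mul b₄) (even_two_mul b₆) hr4 hπ hF hh' κ hκ

/-- **`FineMuZeroAt` corollary, cubic-model shape** (pen certificate :83, verbatim) in the currency of the registry's (α) binder
(`Rank1Residual.FineMuZeroAt · 2`). [cite: Lim2017FineSelmer, §3 Thm. 3.5 and Lemma 3.2] [cite: CoatesSujatha2005, §3 statement (A)] -/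
theorem fineMuZeroAt_two_cubicModel_goodSSShape_of_oddClassNumber
    (hLim2 : Lim2017.thm35_at_two_fineSelmerDual_moduleFinite_of_classicalMuVanishes_of_le_divisionField_four)
    (c b₄ b₆ : ℤ) (hb₆ : Odd b₆)
    [((⟨0, ((4 * c : ℤ) : ℚ), 0, ((8 * b₄ : ℤ) : ℚ), ((16 * b₆ : ℤ) : ℚ)⟩ : WeierstrassCurve ℚ)).IsElliptic]
    {β : AlgebraicClosure ℚ}
    (hβ : aeval β (Cubic.toPoly ⟨1, ((4 * c : ℤ) : ℚ), ((8 * b₄ : ℤ) : ℚ), ((16 * b₆ : ℤ) : ℚ)⟩) = 0)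
    (hh : ¬ 2 ∣ Nat.card (ClassGroup (𝓞 (IntermediateField.adjoin ℚ {β})))) :
    Literature.NumberTheory.EllipticCurves.Rank1Residual.FineMuZeroAt
      (⟨0, ((4 * c : ℤ) : ℚ), 0, ((8 * b₄ : ℤ) : ℚ), ((16 * b₆ : ℤ) : ℚ)⟩ : WeierstrassCurve ℚ) 2 :=
  Literature.NumberTheory.EllipticCurves.Rank1Residual.ConjAAt.fineMuZeroAt
    (fun κ hκ ↦ conjA_two_cubicModel_goodSSShape_of_oddClassNumber hLim2 c b₄ b₆ hb₆ hβ hh κ hκ)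

end CubicModelDoor

/-! ## §4 GENERATOR SWAP: the displayed bit becomes a KERNEL bit when a small generator `θ(β)` of `ℚ(β)` is supplied -/

section GeneratorSwap

/-- **(A)₂ on the minimal model modulo `hLim2` ALONE, from a generator swap.** Data: the row `[0, a₂, 1, a₄, a₆]` (its `2`-division
cubic is `X³ + 4a₂X² + 16a₄X + (64a₆ + 16)`), an integer cubic `g = X³ + p′X² + q′X + r′`, rationals `u₀ u₁ u₂ v₀ v₁ v₂`. Hypotheses:
for every root `β` of the `2`-division cubic, `θ = u₀ + u₁β + u₂β²` is a root of `g` and `β = v₀ + v₁θ + v₂θ²` (so `ℚ(θ) = ℚ(β)`; per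
row two `linear_combination`s of the cubic relation), and `2 ∤ #Cl(𝓞 ℚ(θ))` for every root `θ ∈ ℚ̄` of `g` (kernel: `…CubicDiscriminant`
`not_two_dvd_card_classGroup_adjoin_of_abs_discr_le`, `…MinkowskiDoor`, or a norm/cube certificate `…ClassNumberOne…/…OddCriterion`).
Conclusion: (A)₂(W) with NO displayed datum. [cite: Lim2017FineSelmer, §3 Thm. 3.5 and Lemma 3.2] [cite: CoatesSujatha2005, §3 statement (A)] -/
theorem conjA_two_goodSSModel_of_generator
    (hLim2 : Lim2017.thm35_at_two_fineSelmerDual_moduleFinite_of_classicalMuVanishes_of_le_divisionField_four)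
    (a₂ a₄ a₆ : ℤ) [((⟨0, a₂, 1, a₄, a₆⟩ : WeierstrassCurve ℤ).baseChange ℚ).IsElliptic]
    (p' q' r' : ℤ) (u₀ u₁ u₂ v₀ v₁ v₂ : ℚ)
    (hswap : ∀ β θ : AlgebraicClosure ℚ,
      β ^ 3 + ((4 * a₂ : ℤ) : AlgebraicClosure ℚ) * β ^ 2 + ((16 * a₄ : ℤ) : AlgebraicClosure ℚ) * β
          + ((64 * a₆ + 16 : ℤ) : AlgebraicClosure ℚ) = 0 →
      θ = (u₀ : AlgebraicClosure ℚ) + (u₁ : AlgebraicClosure ℚ) * β + (u₂ : AlgebraicClosure ℚ) * β ^ 2 →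
        θ ^ 3 + (p' : AlgebraicClosure ℚ) * θ ^ 2 + (q' : AlgebraicClosure ℚ) * θ + (r' : AlgebraicClosure ℚ) = 0 ∧
          β = (v₀ : AlgebraicClosure ℚ) + (v₁ : AlgebraicClosure ℚ) * θ + (v₂ : AlgebraicClosure ℚ) * θ ^ 2)
    (hodd : ∀ θ : AlgebraicClosure ℚ, aeval θ (Cubic.toPoly ⟨1, (p' : ℚ), (q' : ℚ), (r' : ℚ)⟩) = 0 →
      ¬ 2 ∣ Nat.card (ClassGroup (𝓞 (IntermediateField.adjoin ℚ {θ}))))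
    (κ : ZpExtension ℚ 2) (hκ : κ.IsCyclotomic) :
    ∃ (γ : absoluteGaloisGroup ℚ)
      (D : ((⟨0, a₂, 1, a₄, a₆⟩ : WeierstrassCurve ℤ).baseChange ℚ).FineSelmerDualData κ γ),
      Module.Finite ℤ_[2] (RestrictScalars ℤ_[2] (IwasawaAlgebra 2) D.X) := by
  obtain ⟨β, hβ⟩ := IsAlgClosed.exists_aeval_eq_zero (AlgebraicClosure ℚ)
    (Cubic.toPoly ⟨1, ((4 * a₂ : ℤ) : ℚ), ((16 * a₄ : ℤ) : ℚ), ((64 * a₆ + 16 : ℤ) : ℚ)⟩)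
    (by rw [Cubic.degree_of_a_ne_zero one_ne_zero]; norm_num)
  have hβ' := hβ
  simp only [Cubic.toPoly, map_one, one_mul, aeval_add, aeval_mul, aeval_C, aeval_X_pow, aeval_X, eq_ratCast,
    Rat.cast_intCast] at hβ'
  set θ : AlgebraicClosure ℚ := (u₀ : AlgebraicClosure ℚ) + (u₁ : AlgebraicClosure ℚ) * β + (u₂ : AlgebraicClosure ℚ) * β ^ 2
    with hθdef
  obtain ⟨hθ', hβeq⟩ := hswap β θ hβ' hθdef
  have hθ : aeval θ (Cubic.toPoly ⟨1, (p' : ℚ), (q' : ℚ), (r' : ℚ)⟩) = 0 := by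
    simp only [Cubic.toPoly, map_one, one_mul, aeval_add, aeval_mul, aeval_C, aeval_X_pow, aeval_X, eq_ratCast,
      Rat.cast_intCast]
    exact hθ'
  have hcast : ∀ u : ℚ, (u : AlgebraicClosure ℚ) = algebraMap ℚ (AlgebraicClosure ℚ) u := fun u ↦ (eq_ratCast _ u).symm
  have hmem : ∀ (x y : AlgebraicClosure ℚ) (w₀ w₁ w₂ : ℚ), y ∈ IntermediateField.adjoin ℚ {x} →
      (w₀ : AlgebraicClosure ℚ) + (w₁ : AlgebraicClosure ℚ) * y + (w₂ : AlgebraicClosure ℚ) * y ^ 2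
        ∈ IntermediateField.adjoin ℚ {x} := fun x y w₀ w₁ w₂ hy ↦ by
    rw [hcast w₀, hcast w₁, hcast w₂]
    exact add_mem (add_mem (algebraMap_mem _ _) (mul_mem (algebraMap_mem _ _) hy)) (mul_mem (algebraMap_mem _ _) (pow_mem hy 2))
  have hadj : IntermediateField.adjoin ℚ {θ} = IntermediateField.adjoin ℚ {β} := by
    apply le_antisymm <;> rw [IntermediateField.adjoin_simple_le_iff]
    · exact hmem β β u₀ u₁ u₂ (IntermediateField.mem_adjoin_simple_self ℚ β)
    · rw [hβeq]; exact hmem θ θ v₀ v₁ v₂ (IntermediateField.mem_adjoin_simple_self ℚ θ)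
  refine conjA_two_goodSSModel_of_oddClassNumber hLim2 a₂ a₄ a₆ rfl rfl rfl hβ ?_ κ hκ
  rw [← hadj]
  exact hodd θ hθ

/-- **`FineMuZeroAt ([0, a₂, 1, a₄, a₆] ⊗ ℚ) 2` modulo `hLim2` ALONE from a generator swap** (same data as
`conjA_two_goodSSModel_of_generator`). [cite: Lim2017FineSelmer, §3 Thm. 3.5 and Lemma 3.2] [cite: CoatesSujatha2005, §3 statement (A)] -/
theorem fineMuZeroAt_two_goodSSModel_of_generator
    (hLim2 : Lim2017.thm35_at_two_fineSelmerDual_moduleFinite_of_classicalMuVanishes_of_le_divisionField_four)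
    (a₂ a₄ a₆ : ℤ) [((⟨0, a₂, 1, a₄, a₆⟩ : WeierstrassCurve ℤ).baseChange ℚ).IsElliptic]
    (p' q' r' : ℤ) (u₀ u₁ u₂ v₀ v₁ v₂ : ℚ)
    (hswap : ∀ β θ : AlgebraicClosure ℚ,
      β ^ 3 + ((4 * a₂ : ℤ) : AlgebraicClosure ℚ) * β ^ 2 + ((16 * a₄ : ℤ) : AlgebraicClosure ℚ) * β
          + ((64 * a₆ + 16 : ℤ) : AlgebraicClosure ℚ) = 0 →
      θ = (u₀ : AlgebraicClosure ℚ) + (u₁ : AlgebraicClosure ℚ) * β + (u₂ : AlgebraicClosure ℚ) * β ^ 2 →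
        θ ^ 3 + (p' : AlgebraicClosure ℚ) * θ ^ 2 + (q' : AlgebraicClosure ℚ) * θ + (r' : AlgebraicClosure ℚ) = 0 ∧
          β = (v₀ : AlgebraicClosure ℚ) + (v₁ : AlgebraicClosure ℚ) * θ + (v₂ : AlgebraicClosure ℚ) * θ ^ 2)
    (hodd : ∀ θ : AlgebraicClosure ℚ, aeval θ (Cubic.toPoly ⟨1, (p' : ℚ), (q' : ℚ), (r' : ℚ)⟩) = 0 →
      ¬ 2 ∣ Nat.card (ClassGroup (𝓞 (IntermediateField.adjoin ℚ {θ})))) :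
    Literature.NumberTheory.EllipticCurves.Rank1Residual.FineMuZeroAt
      ((⟨0, a₂, 1, a₄, a₆⟩ : WeierstrassCurve ℤ).baseChange ℚ) 2 :=
  Literature.NumberTheory.EllipticCurves.Rank1Residual.ConjAAt.fineMuZeroAt
    (fun κ hκ ↦ conjA_two_goodSSModel_of_generator hLim2 a₂ a₄ a₆ p' q' r' u₀ u₁ u₂ v₀ v₁ v₂ hswap hodd κ hκ)

end GeneratorSwap

end Summit.BirchSwinnertonDyer.BirchSwinnertonDyer.Theorems.AddKatoTwo

end
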